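import Summits.HodgeConjecture.CorCM.Census.OddSliceFacesDescent

/-!
# The group-free face basis: for EVERY finite place set, the rank-four face classes `F(𝟙_Q; i_Q, j_Q)` are a
# unit-triangular `ℤ`-basis of the Hodge lattice modulo divisor pairs (generation half)

COR-CM (cell `pub-hodgecm2`), count-neutral kernel census by the binder seat b09 (gen 27; lane GROUP-FREE-FACE-BASIS = André-3 gen 15's
ask A6-R46, `PORTFOLIO-lit-andre-3-g15.md` §0 (E): «in d-coordinates the faces `F(t; i, j)` with `{i < j}` the two highest flipped positions
of `t` form a UNIT UPPER-TRIANGULAR `ℤ`-basis of `Λ = H/P` … so faces generate `H/P` over `ℤ` for every `(G,c)` of every order with a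
certificate that needs no search»).  Bookkeeping definitions + theorems, Mathlib-only mathematics; no `decide` table, no certificate, no
named fact, no geometry, no `sorry`.  HC_CM is not proved anywhere in this cell; nothing here is a headline and nothing here produces a period.

THE MODEL IS GROUP-FREE.  The representative-free label model of `Census/OddSliceFacesModel.lean` — labels `Ty A = A → ℤ/2`, Pohlmann
coefficients `coef`, the Hodge lattice `hodge A`, the divisor pairs `pairs A` — and the face classes `faceVec A φ i j` of
`Census/OddSliceFacesSquares.lean` use NO structure on `A` (their signatures take `[Fintype A] [DecidableEq A]` only): `A` is just the
set of infinite places of the CM field.  For ANY Galois CM type `(G, c)` of order `2n` choose one representative `g_π` of each place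
`π = {g_π, c g_π}`; a CM type `L ⊂ G` is then the map `ψ_L : places → ℤ/2`, `ψ_L(π) = 0 ⟺ g_π ∈ L`, and `t = c^a g_π` lies in `L` iff
`ψ_L(π) = a` — so Pohlmann's form of `t` [cite: Pohlmann1968, Thm 1] is `coef (a, π)`, the conjugate pair `{L, cL}` is `{ψ, ψ + 1}`, the flip
at the place `π` is `+ δ π`, and the corner set `{Φ, Φ̄^{(π)}, Φ̄^{(π')}, Φ^{(ππ')}}` of the rank-four face `(Φ; π, π')` is exactly the support
of `faceVec A ψ_Φ π π'`.  The group enters only through the Galois ACTION on labels (orbits, blocks), which this file never uses.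
Hence everything below holds for every Galois CM type of every order `2n = 2|A|` (the lane's `ℤ/2 × A` slices, b17's cyclic and
dicyclic models, André-3's atlases of degree `8 … 20`, after the evident relabelling).

CONTENT (`n = |A|`, a base place `i₀ ∈ A` fixed; `e_ψ := Pi.single ψ 1`).
* §1 `faceSpan A = ℤ⟨faceVec A φ i j : i ≠ j⟩ ≤ H`; `ind` is injective, `𝟙_∅ = 0`, `𝟙_{{s}} = δ s`.
* §2 The BASIS FACES: index set `BIdx A i₀ = {Q ⊆ A : i₀ ∉ Q, |Q| ≥ 2}` (of cardinality `2^{n-1} - n`, §2), and for ANY two-place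
  selector `sel` (`sel Q = (i_Q, j_Q)`, `i_Q ≠ j_Q ∈ Q` whenever `|Q| ≥ 2` — e.g. the two highest places of `Q` in any order of the
  places, André-3's choice; a selector always exists, `exists_selector`) the face classes `bvec A sel Q = faceVec A 𝟙_Q i_Q j_Q` and
  their span `bSpan A i₀ sel`.
* §3 GENERATION (`hodge_eq_pairs_sup_bSpan`): **`H = P ⊔ ℤ⟨bvec Q : Q ∈ BIdx⟩`** for every `i₀` and every selector — by the type-square
  identity `faceVec 𝟙_Q i j ≡ e_{𝟙_Q} − e_{𝟙_{Q∖i}} − e_{𝟙_{Q∖j}} + e_{𝟙_{Q∖{i,j}}} (mod P)` (`faceVec_ind_sub_mem_pairs`, already in the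
  tree) every `e_ψ` reduces modulo `P ⊔ ℤ⟨bvec⟩` to the `n` small labels `e_0`, `e_{δ s}` (`s ≠ i₀`) (`sup_smallSpan_eq_top`), and a
  Hodge vector supported on the small labels is `0` (`eq_zero_of_mem_hodge_of_mem_smallSpan`: the `n` place forms are unitriangular
  on them).  A fortiori **`H = P ⊔ faceSpan`** (`hodge_eq_pairs_sup_faceSpan`): the rank-four face classes generate the Hodge lattice
  of the full slice modulo divisor pairs over `ℤ`, for every finite place set, with no certificate and no parity hypothesis.
The independence half (the `bvec Q` are independent modulo `P`, unit-triangular for `⊆`; unique integer face coordinates; `H/P` free of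
rank `2^{n-1} - n`) is the sequel `Census/GroupFreeFaceCoordinates.lean`, and the rank law `μ(G,c) ≥ ⌈(2^{n-1} − n)/n⌉` the file after it.

## References
* [Pohlmann1968] H. Pohlmann, Algebraic cycles on abelian varieties of complex multiplication type, Ann. of Math. 88 (1968), Thm 1.
* [Milne1999] J. S. Milne, Lefschetz motives and the Tate conjecture, Compositio Math. 117 (1999), Prop. 2.1, p. 54.
-/

namespace Summit.HodgeConjecture.CorCM.Census.GroupFreeFaceBasis

open Finset OddSliceFacesModel OddSliceFacesSquares OddSliceFacesDescent

variable (A : Type) [Fintype A] [DecidableEq A]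

/-! ## §1 The span of all face classes; indicator bookkeeping -/

/-- The `ℤ`-span of ALL rank-four face classes `faceVec A φ i j`, `i ≠ j` (no Galois action involved). [folklore] -/
def faceSpan : Submodule ℤ (Ty A → ℤ) :=
  Submodule.span ℤ {v | ∃ (φ : Ty A) (i j : A), i ≠ j ∧ faceVec A φ i j = v}

/-- Every face class lies in `faceSpan`. [folklore] -/
theorem faceVec_mem_faceSpan (φ : Ty A) {i j : A} (hij : i ≠ j) : faceVec A φ i j ∈ faceSpan A :=
  Submodule.subset_span ⟨φ, i, j, hij, rfl⟩

/-- `faceSpan ≤ H` (face classes are Hodge vectors, `faceVec_mem`). [folklore] -/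
theorem faceSpan_le_hodge : faceSpan A ≤ hodge A := by
  refine Submodule.span_le.mpr ?_
  rintro _ ⟨φ, i, j, hij, rfl⟩
  exact faceVec_mem A φ hij

omit [Fintype A] in
/-- `ind` is injective: `𝟙_Q = 𝟙_R ↔ Q = R`. [folklore] -/
theorem ind_injective : Function.Injective (ind A) := by
  intro Q R h
  ext s
  have hs := congrFun h s
  simp only [ind] at hs
  by_cases hQ : s ∈ Q
  · by_cases hR : s ∈ R
    · exact ⟨fun _ => hR, fun _ => hQ⟩
    · rw [if_pos hQ, if_neg hR] at hs
      exact absurd hs (by decide)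
  · by_cases hR : s ∈ R
    · rw [if_neg hQ, if_pos hR] at hs
      exact absurd hs (by decide)
    · exact ⟨fun h => absurd h hQ, fun h => absurd h hR⟩

omit [Fintype A] in
/-- `𝟙_∅ = 0`. [folklore] -/
theorem ind_empty : ind A ∅ = 0 := by
  funext s
  simp [ind]

omit [Fintype A] in
/-- `𝟙_{{s}} = δ s`. [folklore] -/
theorem ind_singleton (s : A) : ind A {s} = δ A s := by
  funext s'
  simp only [ind, Finset.mem_singleton, delta_apply]

omit [Fintype A] in
/-- A conjugate label `𝟙_Q + 1` is never an indicator `𝟙_R` of a set avoiding a place that `Q` avoids. [folklore] -/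
theorem ind_add_one_ne_ind {i₀ : A} {Q R : Finset A} (hQ : i₀ ∉ Q) (hR : i₀ ∉ R) : ind A Q + 1 ≠ ind A R := by
  intro h
  have h0 := congrFun h i₀
  simp only [Pi.add_apply, Pi.one_apply, ind, if_neg hQ, if_neg hR] at h0
  exact absurd h0 (by decide)

/-! ## §2 The basis faces -/

/-- The index set of the face basis at the base place `i₀`: sets of places `Q` with `i₀ ∉ Q` and `|Q| ≥ 2`. [folklore] -/
abbrev BIdx (i₀ : A) : Type := {Q : Finset A // i₀ ∉ Q ∧ 1 < Q.card}

omit [Fintype A] [DecidableEq A] in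
/-- A two-place selector exists (on a nonempty place set): for every `Q` with `|Q| ≥ 2` a pair of distinct places of `Q`. [folklore] -/
theorem exists_selector [Nonempty A] :
    ∃ sel : Finset A → A × A, ∀ Q : Finset A, 1 < Q.card → (sel Q).1 ∈ Q ∧ (sel Q).2 ∈ Q ∧ (sel Q).1 ≠ (sel Q).2 := by
  obtain ⟨a₀⟩ := ‹Nonempty A›
  have h : ∀ Q : Finset A, ∃ p : A × A, 1 < Q.card → p.1 ∈ Q ∧ p.2 ∈ Q ∧ p.1 ≠ p.2 := by
    intro Q
    by_cases hQ : 1 < Q.card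
    · obtain ⟨a, b, ha, hb, hab⟩ := Finset.one_lt_card_iff.mp hQ
      exact ⟨(a, b), fun _ => ⟨ha, hb, hab⟩⟩
    · exact ⟨(a₀, a₀), fun h' => absurd h' hQ⟩
  choose sel hsel using h
  exact ⟨sel, hsel⟩

/-- The basis face class of `Q` for the selector `sel`: `faceVec 𝟙_Q i_Q j_Q`. [folklore] -/
def bvec (sel : Finset A → A × A) (Q : Finset A) : Ty A → ℤ := faceVec A (ind A Q) (sel Q).1 (sel Q).2

/-- The span of the basis faces `bvec Q`, `Q ∈ BIdx A i₀`. [folklore] -/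
def bSpan (i₀ : A) (sel : Finset A → A × A) : Submodule ℤ (Ty A → ℤ) :=
  Submodule.span ℤ (Set.range fun Q : BIdx A i₀ => bvec A sel Q.1)

/-- The basis faces are faces: `bSpan ≤ faceSpan`. [folklore] -/
theorem bSpan_le_faceSpan (i₀ : A) {sel : Finset A → A × A}
    (hsel : ∀ Q : Finset A, 1 < Q.card → (sel Q).1 ∈ Q ∧ (sel Q).2 ∈ Q ∧ (sel Q).1 ≠ (sel Q).2) :
    bSpan A i₀ sel ≤ faceSpan A := by
  refine Submodule.span_le.mpr ?_
  rintro _ ⟨Q, rfl⟩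
  exact faceVec_mem_faceSpan A _ (hsel Q.1 Q.2.2).2.2

/-- `bSpan ≤ H`. [folklore] -/
theorem bSpan_le_hodge (i₀ : A) {sel : Finset A → A × A}
    (hsel : ∀ Q : Finset A, 1 < Q.card → (sel Q).1 ∈ Q ∧ (sel Q).2 ∈ Q ∧ (sel Q).1 ≠ (sel Q).2) :
    bSpan A i₀ sel ≤ hodge A :=
  (bSpan_le_faceSpan A i₀ hsel).trans (faceSpan_le_hodge A)

/-- The basis face of `Q ∈ BIdx` lies in `bSpan`. [folklore] -/
theorem bvec_mem_bSpan {i₀ : A} (sel : Finset A → A × A) {Q : Finset A} (hQ : i₀ ∉ Q) (h1 : 1 < Q.card) :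
    bvec A sel Q ∈ bSpan A i₀ sel :=
  Submodule.subset_span ⟨⟨Q, hQ, h1⟩, rfl⟩

/-! ## §3 Generation: `H = P ⊔ ℤ⟨bvec⟩` -/

/-- The `n` small labels at the base place `i₀`: `e_0` (indexed by `i₀` itself) and `e_{δ s}`, `s ≠ i₀`. [folklore] -/
def smallVec (i₀ s : A) : Ty A → ℤ := if s = i₀ then Pi.single (0 : Ty A) 1 else Pi.single (δ A s) 1

/-- The span of the small labels. [folklore] -/
def smallSpan (i₀ : A) : Submodule ℤ (Ty A → ℤ) := Submodule.span ℤ (Set.range (smallVec A i₀))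

/-- `e_0` is small. [folklore] -/
theorem single_zero_mem_smallSpan (i₀ : A) : Pi.single (0 : Ty A) (1 : ℤ) ∈ smallSpan A i₀ := by
  have h : smallVec A i₀ i₀ = Pi.single (0 : Ty A) 1 := by simp [smallVec]
  rw [← h]
  exact Submodule.subset_span ⟨i₀, rfl⟩

/-- `e_{δ s}` is small for `s ≠ i₀`. [folklore] -/
theorem single_delta_mem_smallSpan {i₀ s : A} (hs : s ≠ i₀) : Pi.single (δ A s) (1 : ℤ) ∈ smallSpan A i₀ := by
  have h : smallVec A i₀ s = Pi.single (δ A s) 1 := by simp [smallVec, hs]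
  rw [← h]
  exact Submodule.subset_span ⟨s, rfl⟩

/-- **Reduction of indicator labels.**  For every `Q` avoiding `i₀`, `e_{𝟙_Q} ∈ P ⊔ ℤ⟨bvec⟩ ⊔ small` — by induction on `|Q|`
through the type-square identity. [folklore] -/
theorem single_ind_mem (i₀ : A) {sel : Finset A → A × A}
    (hsel : ∀ Q : Finset A, 1 < Q.card → (sel Q).1 ∈ Q ∧ (sel Q).2 ∈ Q ∧ (sel Q).1 ≠ (sel Q).2) :
    ∀ (n : ℕ) (Q : Finset A), Q.card ≤ n → i₀ ∉ Q →
      (Pi.single (ind A Q) (1 : ℤ) : Ty A → ℤ) ∈ pairs A ⊔ bSpan A i₀ sel ⊔ smallSpan A i₀ := by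
  intro n
  induction n with
  | zero =>
    intro Q hQ _
    have hQe : Q = ∅ := Finset.card_eq_zero.mp (Nat.le_zero.mp hQ)
    rw [hQe, ind_empty]
    exact Submodule.mem_sup_right (single_zero_mem_smallSpan A i₀)
  | succ n ih =>
    intro Q hQ hi₀
    by_cases h1 : 1 < Q.card
    · obtain ⟨hi, hj, hij⟩ := hsel Q h1
      set i := (sel Q).1
      set j := (sel Q).2
      have hp := faceVec_ind_sub_mem_pairs A hi hj hij
      have hb : faceVec A (ind A Q) i j ∈ pairs A ⊔ bSpan A i₀ sel ⊔ smallSpan A i₀ :=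
        Submodule.mem_sup_left (Submodule.mem_sup_right (bvec_mem_bSpan A sel hi₀ h1))
      have hci : (Q.erase i).card ≤ n := by
        have := Finset.card_erase_lt_of_mem hi; omega
      have hcj : (Q.erase j).card ≤ n := by
        have := Finset.card_erase_lt_of_mem hj; omega
      have hcij : ((Q.erase i).erase j).card ≤ n := (Finset.card_le_card (Finset.erase_subset _ _)).trans hci
      have hni : i₀ ∉ Q.erase i := fun h => hi₀ (Finset.mem_of_mem_erase h)
      have hnj : i₀ ∉ Q.erase j := fun h => hi₀ (Finset.mem_of_mem_erase h)
      have hnij : i₀ ∉ (Q.erase i).erase j := fun h => hni (Finset.mem_of_mem_erase h)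
      have ei := ih _ hci hni
      have ej := ih _ hcj hnj
      have eij := ih _ hcij hnij
      have hP : faceVec A (ind A Q) i j - (Pi.single (ind A Q) 1 - Pi.single (ind A (Q.erase i)) 1
          - Pi.single (ind A (Q.erase j)) 1 + Pi.single (ind A ((Q.erase i).erase j)) 1)
            ∈ pairs A ⊔ bSpan A i₀ sel ⊔ smallSpan A i₀ :=
        Submodule.mem_sup_left (Submodule.mem_sup_left hp)
      have key : (Pi.single (ind A Q) (1 : ℤ) : Ty A → ℤ) =
          faceVec A (ind A Q) i j - (faceVec A (ind A Q) i j - (Pi.single (ind A Q) 1 - Pi.single (ind A (Q.erase i)) 1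
            - Pi.single (ind A (Q.erase j)) 1 + Pi.single (ind A ((Q.erase i).erase j)) 1))
          + Pi.single (ind A (Q.erase i)) 1 + Pi.single (ind A (Q.erase j)) 1 - Pi.single (ind A ((Q.erase i).erase j)) 1 := by
        abel
      rw [key]
      exact Submodule.sub_mem _ (Submodule.add_mem _ (Submodule.add_mem _ (Submodule.sub_mem _ hb hP) ei) ej) eij
    · -- `|Q| ≤ 1`: `Q = ∅` or `Q = {s}` with `s ≠ i₀`
      rcases Nat.lt_or_ge Q.card 1 with h0 | h1'
      · have hQe : Q = ∅ := Finset.card_eq_zero.mp (by omega)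
        rw [hQe, ind_empty]
        exact Submodule.mem_sup_right (single_zero_mem_smallSpan A i₀)
      · obtain ⟨s, hs⟩ := Finset.card_eq_one.mp (le_antisymm (by omega) h1')
        have hsi : s ≠ i₀ := by
          rintro rfl
          exact hi₀ (by rw [hs]; exact Finset.mem_singleton_self _)
        rw [hs, ind_singleton]
        exact Submodule.mem_sup_right (single_delta_mem_smallSpan A hsi)

/-- Every unit vector `e_ψ` lies in `P ⊔ ℤ⟨bvec⟩ ⊔ small`. [folklore] -/
theorem single_mem (i₀ : A) {sel : Finset A → A × A}
    (hsel : ∀ Q : Finset A, 1 < Q.card → (sel Q).1 ∈ Q ∧ (sel Q).2 ∈ Q ∧ (sel Q).1 ≠ (sel Q).2) (ψ : Ty A) :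
    (Pi.single ψ (1 : ℤ) : Ty A → ℤ) ∈ pairs A ⊔ bSpan A i₀ sel ⊔ smallSpan A i₀ := by
  have h01 : ∀ u : ZMod 2, u = 0 ∨ u = 1 := by decide
  rcases h01 (ψ i₀) with h0 | h1
  · -- `ψ = 𝟙_Q` with `i₀ ∉ Q`
    have hQ : i₀ ∉ univ.filter (fun s => ψ s = 1) := by
      simp only [Finset.mem_filter, Finset.mem_univ, true_and, h0]; decide
    have := single_ind_mem A i₀ hsel _ _ le_rfl hQ
    rwa [ind_filter] at this
  · -- `ψ = χ + 1` with `χ i₀ = 0`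
    set χ := ψ + 1 with hχ
    have hψ : ψ = χ + 1 := (add_one_add_one A ψ).symm
    have hχ0 : χ i₀ = 0 := by
      simp only [hχ, Pi.add_apply, Pi.one_apply, h1]; decide
    have hQ : i₀ ∉ univ.filter (fun s => χ s = 1) := by
      simp only [Finset.mem_filter, Finset.mem_univ, true_and, hχ0]; decide
    have hmem := single_ind_mem A i₀ hsel _ _ le_rfl hQ
    rw [ind_filter] at hmem
    rw [hψ, single_add_one]
    exact Submodule.sub_mem _ (Submodule.mem_sup_left (Submodule.mem_sup_left
      (Submodule.subset_span ⟨χ, rfl⟩))) hmem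

/-- `P ⊔ ℤ⟨bvec⟩ ⊔ small = ⊤`. [folklore] -/
theorem sup_smallSpan_eq_top (i₀ : A) {sel : Finset A → A × A}
    (hsel : ∀ Q : Finset A, 1 < Q.card → (sel Q).1 ∈ Q ∧ (sel Q).2 ∈ Q ∧ (sel Q).1 ≠ (sel Q).2) :
    pairs A ⊔ bSpan A i₀ sel ⊔ smallSpan A i₀ = ⊤ := by
  refine eq_top_iff.mpr ?_
  rw [← (Pi.basisFun ℤ (Ty A)).span_eq]
  refine Submodule.span_le.mpr ?_
  rintro _ ⟨ψ, rfl⟩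
  rw [Pi.basisFun_apply]
  exact single_mem A i₀ hsel ψ

/-- A vector of the small span is `c_{i₀} • e_0 + Σ_s c'_s • e_{δ s}` with `c'` vanishing at `i₀`. [folklore] -/
theorem exists_of_mem_smallSpan {i₀ : A} {u : Ty A → ℤ} (hu : u ∈ smallSpan A i₀) :
    ∃ c : A → ℤ, c i₀ = 0 ∧ u = u (0 : Ty A) • Pi.single (0 : Ty A) 1 + ∑ s, c s • Pi.single (δ A s) 1 := by
  obtain ⟨c, hc⟩ := (Submodule.mem_span_range_iff_exists_fun ℤ).mp hu
  refine ⟨Function.update c i₀ 0, Function.update_self .., ?_⟩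
  have hsplit : ∑ s, c s • smallVec A i₀ s =
      c i₀ • Pi.single (0 : Ty A) 1 + ∑ s, Function.update c i₀ 0 s • Pi.single (δ A s) 1 := by
    have hterm : ∀ s, c s • smallVec A i₀ s =
        (if s = i₀ then c s else 0) • Pi.single (0 : Ty A) (1 : ℤ) + Function.update c i₀ 0 s • Pi.single (δ A s) 1 := by
      intro s
      by_cases h : s = i₀
      · subst h; simp [smallVec]
      · simp [smallVec, h]
    simp_rw [hterm]
    rw [Finset.sum_add_distrib, ← Finset.sum_smul, Finset.sum_ite_eq' univ i₀ c]
    simp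
  have hu0 : u (0 : Ty A) = c i₀ := by
    rw [← hc, hsplit]
    simp only [Pi.add_apply, Finset.sum_apply, Pi.smul_apply, Pi.single_eq_same, smul_eq_mul, mul_one]
    have hz : ∀ s, Function.update c i₀ 0 s * (Pi.single (δ A s) (1 : ℤ) : Ty A → ℤ) 0 = 0 := by
      intro s
      rw [Pi.single_apply, if_neg (delta_ne_zero A s).symm, mul_zero]
    simp [hz]
  rw [hu0, ← hc, hsplit]

/-- **A Hodge vector supported on the small labels is zero** (the `n` place forms are unitriangular on `e_0, e_{δ s}`). [folklore] -/
theorem eq_zero_of_mem_hodge_of_mem_smallSpan {i₀ : A} {u : Ty A → ℤ} (hH : u ∈ hodge A) (hu : u ∈ smallSpan A i₀) :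
    u = 0 := by
  obtain ⟨c, hc0, hu'⟩ := exists_of_mem_smallSpan A hu
  rw [mem_hodge_iff] at hH
  have hform : ∀ t : A, u (0 : Ty A) + (∑ s, c s - 2 * c t) = 0 := by
    intro t
    have := hH t
    rw [hu', dotProduct_add, coef_zero_dotProduct_single_zero, coef_zero_dotProduct_sum_delta] at this
    exact this
  have h0 := hform i₀
  rw [hc0, mul_zero, sub_zero] at h0
  have hc : ∀ t, c t = 0 := by
    intro t
    have := hform t
    omega
  have hu0 : u (0 : Ty A) = 0 := by
    rw [Finset.sum_eq_zero (fun s _ => hc s)] at h0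
    omega
  rw [hu', hu0, zero_smul, zero_add]
  exact Finset.sum_eq_zero fun s _ => by rw [hc s, zero_smul]

/-- **GENERATION BY THE BASIS FACES.**  For every base place `i₀` and every two-place selector, `H = P ⊔ ℤ⟨faceVec 𝟙_Q i_Q j_Q :
i₀ ∉ Q, |Q| ≥ 2⟩`. [folklore] -/
theorem hodge_eq_pairs_sup_bSpan (i₀ : A) {sel : Finset A → A × A}
    (hsel : ∀ Q : Finset A, 1 < Q.card → (sel Q).1 ∈ Q ∧ (sel Q).2 ∈ Q ∧ (sel Q).1 ≠ (sel Q).2) :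
    hodge A = pairs A ⊔ bSpan A i₀ sel := by
  refine le_antisymm ?_ (sup_le (pairs_le_hodge A) (bSpan_le_hodge A i₀ hsel))
  intro v hv
  have htop : v ∈ pairs A ⊔ bSpan A i₀ sel ⊔ smallSpan A i₀ := by
    rw [sup_smallSpan_eq_top A i₀ hsel]; exact Submodule.mem_top
  obtain ⟨w, hw, u, hu, rfl⟩ := Submodule.mem_sup.mp htop
  have huH : u ∈ hodge A := by
    have hwH : w ∈ hodge A := (sup_le (pairs_le_hodge A) (bSpan_le_hodge A i₀ hsel)) hw
    have := Submodule.sub_mem _ hv hwH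
    rwa [add_sub_cancel_left] at this
  rw [eq_zero_of_mem_hodge_of_mem_smallSpan A huH hu, add_zero]
  exact hw

/-- **GENERATION BY FACES, GROUP-FREE.**  For every nonempty finite place set: `H = P ⊔ ℤ⟨all rank-four face classes⟩` — the face
classes generate the Hodge lattice of the full slice modulo divisor pairs over `ℤ`. [folklore] -/
theorem hodge_eq_pairs_sup_faceSpan [Nonempty A] : hodge A = pairs A ⊔ faceSpan A := by
  obtain ⟨i₀⟩ := ‹Nonempty A›
  obtain ⟨sel, hsel⟩ := exists_selector A
  refine le_antisymm ?_ (sup_le (pairs_le_hodge A) (faceSpan_le_hodge A))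
  rw [hodge_eq_pairs_sup_bSpan A i₀ hsel]
  exact sup_le_sup_left (bSpan_le_faceSpan A i₀ hsel) _

/-- Pointwise form of the generation theorem: every Hodge vector is a pair vector plus an integer combination of the basis
faces. [folklore] -/
theorem exists_coords (i₀ : A) {sel : Finset A → A × A}
    (hsel : ∀ Q : Finset A, 1 < Q.card → (sel Q).1 ∈ Q ∧ (sel Q).2 ∈ Q ∧ (sel Q).1 ≠ (sel Q).2)
    {v : Ty A → ℤ} (hv : v ∈ hodge A) :
    ∃ c : BIdx A i₀ → ℤ, v - ∑ Q, c Q • bvec A sel Q.1 ∈ pairs A := by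
  rw [hodge_eq_pairs_sup_bSpan A i₀ hsel] at hv
  obtain ⟨p, hp, b, hb, rfl⟩ := Submodule.mem_sup.mp hv
  obtain ⟨c, hc⟩ := (Submodule.mem_span_range_iff_exists_fun ℤ).mp hb
  refine ⟨c, ?_⟩
  rw [hc, add_sub_cancel_right]
  exact hp

end Summit.HodgeConjecture.CorCM.Census.GroupFreeFaceBasis
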